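import Mathlib
import Summits.Ventures.PercRepro2.Defs
import Summits.Ventures.PercRepro2.Independence
import Summits.Ventures.PercRepro2.Harris
import Summits.Ventures.PercRepro2.CoinDefs
import Summits.Ventures.PercRepro2.CoinArcsOff
import Summits.Ventures.PercRepro2.CoinPendantDefs
import Summits.Ventures.PercRepro2.CoinPendant
import Summits.Ventures.PercRepro2.CoinInduced
import Summits.Ventures.PercRepro2.CoinVdBK
import Summits.Ventures.PercRepro2.CoinBHK
import Summits.Ventures.PercRepro2.CoinReverse
import Summits.Ventures.PercRepro2.CoinLemmaA
import Summits.Ventures.PercRepro2.CoinDarcMixed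
import Summits.Ventures.PercRepro2.CoinTwoPendantDefs
import Summits.Ventures.PercRepro2.CoinTwoPendantMass
import Summits.Ventures.PercRepro2.CoinTraceLevels
import Summits.Ventures.PercRepro2.CoinTraceTower
import Summits.Ventures.PercRepro2.CoinTracePin
import Summits.Ventures.PercRepro2.CoinTraceReduce
import Summits.Ventures.PercRepro2.CoinTraceFn
import Summits.Ventures.PercRepro2.CoinTraceBlock
import Summits.Ventures.PercRepro2.CoinTraceShift
import Summits.Ventures.PercRepro2.CoinTwoStarAbstract
import Summits.Ventures.PercRepro2.CoinTwoStar
import Summits.Ventures.PercRepro2.CoinFunctionalDefs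
import Summits.Ventures.PercRepro2.CoinFunctionalReduce

/-!
# The 2-STAR head in FUNCTIONAL form (blind cell PercRepro2, night-2 g3; proofs/NIGHT2-DARC.md
§22.1)

`darcF_of_twoStar_mixed`: `darc_of_twoStar_mixed` for increasing `[0, 1]`-valued cluster
functionals blind to the star — the same abstract lemma `twoStar_functional_nonneg`, the same
trace-law inputs, the marker lemmas replaced by `shiftF` / `massE_le_prob_of_le_one`.
-/

namespace Summit.Ventures.PercRepro2.Coin

section TwoStarF

open Classical

variable {V : Type*} {E : Type*} [Fintype V] [DecidableEq V] [Fintype E] [DecidableEq E]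
  {R : Type*} [Field R] [LinearOrder R] [IsStrictOrderedRing R]

/-- **THEOREM (the 2-star head, FUNCTIONAL form):** row 2′DARC for increasing `[0, 1]`-valued cluster
functionals blind to the star. -/
theorem darcF_of_twoStar_mixed (p : E → R) (hp : IsProbVec p) {arcs : E → Finset (V × V)}
    (hS : SameEnds arcs) (s u w v₁ v₂ t : V) (hwv₁ : w ≠ v₁) (hwv₂ : w ≠ v₂)
    (hv₁₂ : v₁ ≠ v₂) (hclosed : ClosedOut arcs ({w, v₁, v₂} : Finset V) {t}) (hT : TailCoinsIn arcs ({w, v₁, v₂} : Finset V) {t})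
    {c₁ c₂ : E} (hc₁ : c₁ ∈ tailCoins arcs ({w, v₁, v₂} : Finset V)) (hleaf₁ : bwdEvent arcs v₁ {t} = openEdge c₁)
    (hc₂ : c₂ ∈ tailCoins arcs ({w, v₁, v₂} : Finset V)) (hleaf₂ : bwdEvent arcs v₂ {t} = openEdge c₂)
    (hwexit : ∀ ω : Config E, ω ∈ bwdEvent arcs w {t} →
      ω ∈ bwdEvent arcs v₁ {t} ∨ ω ∈ bwdEvent arcs v₂ {t})
    {F₁ F₂ : Set V → R} (hF₁ : Monotone F₁) (hF₂ : Monotone F₂) (hF₁0 : ∀ S, 0 ≤ F₁ S)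
    (hF₂0 : ∀ S, 0 ≤ F₂ S) (hF₁1 : ∀ S, F₁ S ≤ 1) (hF₂1 : ∀ S, F₂ S ≤ 1)
    (hF₁b : ∀ S : Set V, F₁ (S \ ↑(({w, v₁, v₂} : Finset V) ∪ {t})) = F₁ S)
    (hF₂b : ∀ S : Set V, F₂ (S \ ↑(({w, v₁, v₂} : Finset V) ∪ {t})) = F₂ S)
    (hu : u ∉ ({w, v₁, v₂} : Finset V) ∪ {t})
    (hP : ∀ Z ∈ ({w, v₁, v₂} : Finset V).powerset, 0 < prob p (avoidEvent (arcsOff arcs (({w, v₁, v₂} : Finset V) ∪ {t})) s (Z ∪ {t})))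
    (hQ : ∀ Z ∈ ({w, v₁, v₂} : Finset V).powerset,
      0 < prob p (avoidEvent (arcsOff arcs (({w, v₁, v₂} : Finset V) ∪ {t})) s (gateTarget u w Z {t}))) :
    DARCF p arcs s {t} F₁ F₂ u w := by
  have hwP : w ∈ ({w, v₁, v₂} : Finset V) := by simp
  have hv₁P : v₁ ∈ ({w, v₁, v₂} : Finset V) := by simp
  have hv₂P : v₂ ∈ ({w, v₁, v₂} : Finset V) := by simp
  have hS₀ : SameEnds (arcsOff arcs (({w, v₁, v₂} : Finset V) ∪ {t})) := sameEnds_arcsOff hS _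
  refine darcF_of_trace_functional p hp hS hclosed hT s u w hwP hF₁ hF₂ hF₁0 hF₂0 hF₁b hF₂b hu
    hQ ?_
  set D₀ := arcsOff arcs (({w, v₁, v₂} : Finset V) ∪ {t}) with hD₀
  set X₀ : Config E → R := fun ω => F₁ (clusterC D₀ ω s) with hX₀
  set Y₀ : Config E → R := fun ω => F₂ (clusterC D₀ ω s) with hY₀
  -- the trace data
  set ℓ : Finset V → R := fun Z => prob p (traceLevel arcs {t} ({w, v₁, v₂} : Finset V) Z) with hℓ
  set Pz : Finset V → R := fun Z => prob p (avoidEvent D₀ s (Z ∪ {t})) with hPz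
  set Qz : Finset V → R := fun Z => prob p (avoidEvent D₀ s (gateTarget u w Z {t})) with hQz
  set Az : Finset V → R := fun Z => massE p X₀ (avoidEvent D₀ s (Z ∪ {t})) with hAz
  set Bz : Finset V → R := fun Z => massE p Y₀ (avoidEvent D₀ s (Z ∪ {t})) with hBz
  set Ahz : Finset V → R := fun Z => massE p X₀ (avoidEvent D₀ s (gateTarget u w Z {t})) with hAhz
  set Bhz : Finset V → R := fun Z => massE p Y₀ (avoidEvent D₀ s (gateTarget u w Z {t})) with hBhz
  have hPpos : ∀ Z : Finset V, Z ⊆ ({w, v₁, v₂} : Finset V) → 0 < Pz Z := fun Z hZ => hP Z (Finset.mem_powerset.mpr hZ)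
  have hQpos : ∀ Z : Finset V, Z ⊆ ({w, v₁, v₂} : Finset V) → 0 < Qz Z := fun Z hZ => hQ Z (Finset.mem_powerset.mpr hZ)
  -- the abstract data
  have hMX : ∑ Z ∈ ({w, v₁, v₂} : Finset V).powerset, Az Z / Pz Z * (ℓ Z * Pz Z) = ∑ Z ∈ ({w, v₁, v₂} : Finset V).powerset, ℓ Z * Az Z := by
    refine Finset.sum_congr rfl fun Z hZ => ?_
    have := (hPpos Z (Finset.mem_powerset.mp hZ)).ne'
    field_simp
  have hMY : ∑ Z ∈ ({w, v₁, v₂} : Finset V).powerset, Bz Z / Pz Z * (ℓ Z * Pz Z) = ∑ Z ∈ ({w, v₁, v₂} : Finset V).powerset, ℓ Z * Bz Z := by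
    refine Finset.sum_congr rfl fun Z hZ => ?_
    have := (hPpos Z (Finset.mem_powerset.mp hZ)).ne'
    field_simp
  have key : ∑ Z ∈ ({w, v₁, v₂} : Finset V).powerset, ℓ Z * Pz Z * (Qz Z / Pz Z) *
        (Ahz Z / Qz Z * (∑ Z' ∈ ({w, v₁, v₂} : Finset V).powerset, ℓ Z' * Pz Z')
          - ∑ Z' ∈ ({w, v₁, v₂} : Finset V).powerset, Az Z' / Pz Z' * (ℓ Z' * Pz Z')) *
        (Bhz Z / Qz Z * (∑ Z' ∈ ({w, v₁, v₂} : Finset V).powerset, ℓ Z' * Pz Z')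
          - ∑ Z' ∈ ({w, v₁, v₂} : Finset V).powerset, Bz Z' / Pz Z' * (ℓ Z' * Pz Z')) =
      ∑ Z ∈ ({w, v₁, v₂} : Finset V).powerset, ℓ Z * Qz Z *
        (Ahz Z / Qz Z * (∑ Z' ∈ ({w, v₁, v₂} : Finset V).powerset, ℓ Z' * Pz Z') - ∑ Z' ∈ ({w, v₁, v₂} : Finset V).powerset, ℓ Z' * Az Z') *
        (Bhz Z / Qz Z * (∑ Z' ∈ ({w, v₁, v₂} : Finset V).powerset, ℓ Z' * Pz Z') - ∑ Z' ∈ ({w, v₁, v₂} : Finset V).powerset, ℓ Z' * Bz Z') := by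
    rw [hMX, hMY]
    refine Finset.sum_congr rfl fun Z hZ => ?_
    have := (hPpos Z (Finset.mem_powerset.mp hZ)).ne'
    field_simp
  rw [← key]
  -- the hypotheses of the abstract lemma
  have hμ : ∀ Z ∈ ({w, v₁, v₂} : Finset V).powerset, 0 ≤ ℓ Z * Pz Z :=
    fun Z _ => mul_nonneg (prob_nonneg hp _) (prob_nonneg hp _)
  have hμw : ℓ {w} * Pz {w} = 0 := by
    have : ℓ {w} = 0 := by
      show prob p (traceLevel arcs {t} ({w, v₁, v₂} : Finset V) {w}) = 0
      rw [traceLevel_singleton_head_eq_empty hwv₁ hwv₂ hwexit, prob_empty]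
    rw [this, zero_mul]
  have hx1 : ∀ Z : Finset V, Z ⊆ ({w, v₁, v₂} : Finset V) → Az Z / Pz Z ≤ 1 := fun Z hZ =>
    (div_le_one₀ (hPpos Z hZ)).mpr (massE_le_prob_of_le_one p hp (fun ω => hF₁1 _) _)
  have hy1 : ∀ Z : Finset V, Z ⊆ ({w, v₁, v₂} : Finset V) → Bz Z / Pz Z ≤ 1 := fun Z hZ =>
    (div_le_one₀ (hPpos Z hZ)).mpr (massE_le_prob_of_le_one p hp (fun ω => hF₂1 _) _)
  have hxh1 : ∀ Z : Finset V, Z ⊆ ({w, v₁, v₂} : Finset V) → Ahz Z / Qz Z ≤ 1 := fun Z hZ =>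
    (div_le_one₀ (hQpos Z hZ)).mpr (massE_le_prob_of_le_one p hp (fun ω => hF₁1 _) _)
  have hyh1 : ∀ Z : Finset V, Z ⊆ ({w, v₁, v₂} : Finset V) → Bhz Z / Qz Z ≤ 1 := fun Z hZ =>
    (div_le_one₀ (hQpos Z hZ)).mpr (massE_le_prob_of_le_one p hp (fun ω => hF₂1 _) _)
  have hxanti : ∀ Z Z' : Finset V, Z ⊆ Z' → Z' ⊆ ({w, v₁, v₂} : Finset V) → Az Z' / Pz Z' ≤ Az Z / Pz Z :=
    fun Z Z' hZZ' hZ'P => (div_le_div_iff₀ (hPpos Z' hZ'P) (hPpos Z (hZZ'.trans hZ'P))).mpr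
      (shiftF p hp hS₀ s hF₁ hF₁0 (Finset.union_subset_union_left hZZ'))
  have hyanti : ∀ Z Z' : Finset V, Z ⊆ Z' → Z' ⊆ ({w, v₁, v₂} : Finset V) → Bz Z' / Pz Z' ≤ Bz Z / Pz Z :=
    fun Z Z' hZZ' hZ'P => (div_le_div_iff₀ (hPpos Z' hZ'P) (hPpos Z (hZZ'.trans hZ'P))).mpr
      (shiftF p hp hS₀ s hF₂ hF₂0 (Finset.union_subset_union_left hZZ'))
  have hxhanti : ∀ Z Z' : Finset V, Z ⊆ Z' → Z' ⊆ ({w, v₁, v₂} : Finset V) → Ahz Z' / Qz Z' ≤ Ahz Z / Qz Z :=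
    fun Z Z' hZZ' hZ'P => (div_le_div_iff₀ (hQpos Z' hZ'P) (hQpos Z (hZZ'.trans hZ'P))).mpr
      (shiftF p hp hS₀ s hF₁ hF₁0 (gateTarget_mono u w hZZ' {t}))
  have hyhanti : ∀ Z Z' : Finset V, Z ⊆ Z' → Z' ⊆ ({w, v₁, v₂} : Finset V) → Bhz Z' / Qz Z' ≤ Bhz Z / Qz Z :=
    fun Z Z' hZZ' hZ'P => (div_le_div_iff₀ (hQpos Z' hZ'P) (hQpos Z (hZZ'.trans hZ'P))).mpr
      (shiftF p hp hS₀ s hF₂ hF₂0 (gateTarget_mono u w hZZ' {t}))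
  have hxh_le : ∀ Z : Finset V, Z ⊆ ({w, v₁, v₂} : Finset V) → Ahz Z / Qz Z ≤ Az Z / Pz Z := fun Z hZ =>
    (div_le_div_iff₀ (hQpos Z hZ) (hPpos Z hZ)).mpr
      (shiftF p hp hS₀ s hF₁ hF₁0 (subset_gateTarget u w Z {t}))
  have hyh_le : ∀ Z : Finset V, Z ⊆ ({w, v₁, v₂} : Finset V) → Bhz Z / Qz Z ≤ Bz Z / Pz Z := fun Z hZ =>
    (div_le_div_iff₀ (hQpos Z hZ) (hPpos Z hZ)).mpr
      (shiftF p hp hS₀ s hF₂ hF₂0 (subset_gateTarget u w Z {t}))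
  have hxh_eq : ∀ Z : Finset V, Z ⊆ ({w, v₁, v₂} : Finset V) → w ∉ Z → Ahz Z / Qz Z = Az Z / Pz Z := by
    intro Z _ hwZ
    show massE p X₀ (avoidEvent D₀ s (gateTarget u w Z {t})) /
        prob p (avoidEvent D₀ s (gateTarget u w Z {t})) = _
    rw [gateTarget_of_notMem hwZ]
  have hyh_eq : ∀ Z : Finset V, Z ⊆ ({w, v₁, v₂} : Finset V) → w ∉ Z → Bhz Z / Qz Z = Bz Z / Pz Z := by
    intro Z _ hwZ
    show massE p Y₀ (avoidEvent D₀ s (gateTarget u w Z {t})) /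
        prob p (avoidEvent D₀ s (gateTarget u w Z {t})) = _
    rw [gateTarget_of_notMem hwZ]
  have hρ1 : ∀ Z ∈ ({w, v₁, v₂} : Finset V).powerset, w ∉ Z → Qz Z / Pz Z = 1 := by
    intro Z hZ hwZ
    show prob p (avoidEvent D₀ s (gateTarget u w Z {t})) / prob p (avoidEvent D₀ s (Z ∪ {t})) = 1
    rw [gateTarget_of_notMem hwZ]
    exact div_self (hP Z hZ).ne'
  have hρ0 : ∀ Z ∈ ({w, v₁, v₂} : Finset V).powerset, 0 ≤ Qz Z / Pz Z :=
    fun Z _ => div_nonneg (prob_nonneg hp _) (prob_nonneg hp _)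
  have hρle : Qz ({w, v₁, v₂} : Finset V) / Pz ({w, v₁, v₂} : Finset V) ≤ 1 :=
    (div_le_one₀ (hPpos ({w, v₁, v₂} : Finset V) (subset_refl _))).mpr
      (prob_mono hp fun ω hω t' ht' => hω t' (subset_gateTarget u w ({w, v₁, v₂} : Finset V) {t} ht'))
  have hρ₁ : Qz {w, v₁} / Pz {w, v₁} ≤ Qz ({w, v₁, v₂} : Finset V) / Pz ({w, v₁, v₂} : Finset V) :=
    (div_le_div_iff₀ (hPpos _ (by simp [Finset.insert_subset_iff])) (hPpos ({w, v₁, v₂} : Finset V) (subset_refl _))).mpr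
      (rho_mono_of_subset p hp hS s u w hu (by simp [Finset.insert_subset_iff]) (subset_refl _)
        (by simp))
  have hρ₂ : Qz {w, v₂} / Pz {w, v₂} ≤ Qz ({w, v₁, v₂} : Finset V) / Pz ({w, v₁, v₂} : Finset V) :=
    (div_le_div_iff₀ (hPpos _ (by simp [Finset.insert_subset_iff])) (hPpos ({w, v₁, v₂} : Finset V) (subset_refl _))).mpr
      (rho_mono_of_subset p hp hS s u w hu (by simp [Finset.insert_subset_iff]) (subset_refl _)
        (by simp))
  -- the two positive-association inputs
  have hPA : TracePA ({w, v₁, v₂} : Finset V) (fun Z => ℓ Z * Pz Z) := by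
    intro U hU f₁ f₂ h₁ h₂ h₁0 h₂0
    have h := trace_pa p hp hS hclosed hT hU s (monotone_traceFn ({w, v₁, v₂} : Finset V) h₁) (monotone_traceFn ({w, v₁, v₂} : Finset V) h₂)
      (traceFn_nonneg ({w, v₁, v₂} : Finset V) h₁0) (traceFn_nonneg ({w, v₁, v₂} : Finset V) h₂0)
    have e₁ : ∑ Z ∈ ({w, v₁, v₂} : Finset V).powerset.filter (fun Z => Disjoint Z U),
        traceFn ({w, v₁, v₂} : Finset V) f₁ ↑Z * (ℓ Z * Pz Z) =
        ∑ Z ∈ ({w, v₁, v₂} : Finset V).powerset.filter (fun Z => Disjoint Z U), f₁ Z * (ℓ Z * Pz Z) :=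
      Finset.sum_congr rfl fun Z hZ => by
        rw [traceFn_coe ({w, v₁, v₂} : Finset V) f₁ (Finset.mem_powerset.mp (Finset.mem_filter.mp hZ).1)]
    have e₂ : ∑ Z ∈ ({w, v₁, v₂} : Finset V).powerset.filter (fun Z => Disjoint Z U),
        traceFn ({w, v₁, v₂} : Finset V) f₂ ↑Z * (ℓ Z * Pz Z) =
        ∑ Z ∈ ({w, v₁, v₂} : Finset V).powerset.filter (fun Z => Disjoint Z U), f₂ Z * (ℓ Z * Pz Z) :=
      Finset.sum_congr rfl fun Z hZ => by
        rw [traceFn_coe ({w, v₁, v₂} : Finset V) f₂ (Finset.mem_powerset.mp (Finset.mem_filter.mp hZ).1)]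
    have e₁₂ : ∑ Z ∈ ({w, v₁, v₂} : Finset V).powerset.filter (fun Z => Disjoint Z U),
        traceFn ({w, v₁, v₂} : Finset V) f₁ ↑Z * traceFn ({w, v₁, v₂} : Finset V) f₂ ↑Z * (ℓ Z * Pz Z) =
        ∑ Z ∈ ({w, v₁, v₂} : Finset V).powerset.filter (fun Z => Disjoint Z U), f₁ Z * f₂ Z * (ℓ Z * Pz Z) :=
      Finset.sum_congr rfl fun Z hZ => by
        rw [traceFn_coe ({w, v₁, v₂} : Finset V) f₁ (Finset.mem_powerset.mp (Finset.mem_filter.mp hZ).1),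
          traceFn_coe ({w, v₁, v₂} : Finset V) f₂ (Finset.mem_powerset.mp (Finset.mem_filter.mp hZ).1)]
    rw [e₁, e₂, e₁₂] at h
    exact h
  have hCU : ∀ v : V, v ∈ ({w, v₁, v₂} : Finset V) → ∀ c : E, c ∈ tailCoins arcs ({w, v₁, v₂} : Finset V) →
      bwdEvent arcs v {t} = openEdge c → TraceCUPA ({w, v₁, v₂} : Finset V) (fun Z => ℓ Z * Pz Z) v := by
    intro v hv c hc hleaf f₁ f₂ h₁ h₂ h₁0 h₂0
    have h := trace_cu_pa p hp hS hclosed hT hv hc hleaf s (monotone_traceFn ({w, v₁, v₂} : Finset V) h₁)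
      (monotone_traceFn ({w, v₁, v₂} : Finset V) h₂) (traceFn_nonneg ({w, v₁, v₂} : Finset V) h₁0) (traceFn_nonneg ({w, v₁, v₂} : Finset V) h₂0)
    have e₁ : ∑ Z ∈ ({w, v₁, v₂} : Finset V).powerset.filter (fun Z => v ∈ Z), traceFn ({w, v₁, v₂} : Finset V) f₁ ↑Z * (ℓ Z * Pz Z) =
        ∑ Z ∈ ({w, v₁, v₂} : Finset V).powerset.filter (fun Z => v ∈ Z), f₁ Z * (ℓ Z * Pz Z) :=
      Finset.sum_congr rfl fun Z hZ => by
        rw [traceFn_coe ({w, v₁, v₂} : Finset V) f₁ (Finset.mem_powerset.mp (Finset.mem_filter.mp hZ).1)]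
    have e₂ : ∑ Z ∈ ({w, v₁, v₂} : Finset V).powerset.filter (fun Z => v ∈ Z), traceFn ({w, v₁, v₂} : Finset V) f₂ ↑Z * (ℓ Z * Pz Z) =
        ∑ Z ∈ ({w, v₁, v₂} : Finset V).powerset.filter (fun Z => v ∈ Z), f₂ Z * (ℓ Z * Pz Z) :=
      Finset.sum_congr rfl fun Z hZ => by
        rw [traceFn_coe ({w, v₁, v₂} : Finset V) f₂ (Finset.mem_powerset.mp (Finset.mem_filter.mp hZ).1)]
    have e₁₂ : ∑ Z ∈ ({w, v₁, v₂} : Finset V).powerset.filter (fun Z => v ∈ Z),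
        traceFn ({w, v₁, v₂} : Finset V) f₁ ↑Z * traceFn ({w, v₁, v₂} : Finset V) f₂ ↑Z * (ℓ Z * Pz Z) =
        ∑ Z ∈ ({w, v₁, v₂} : Finset V).powerset.filter (fun Z => v ∈ Z), f₁ Z * f₂ Z * (ℓ Z * Pz Z) :=
      Finset.sum_congr rfl fun Z hZ => by
        rw [traceFn_coe ({w, v₁, v₂} : Finset V) f₁ (Finset.mem_powerset.mp (Finset.mem_filter.mp hZ).1),
          traceFn_coe ({w, v₁, v₂} : Finset V) f₂ (Finset.mem_powerset.mp (Finset.mem_filter.mp hZ).1)]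
    rw [e₁, e₂, e₁₂] at h
    exact h
  exact twoStar_functional_nonneg hwv₁ hwv₂ hv₁₂ (fun Z => ℓ Z * Pz Z) (fun Z => Az Z / Pz Z)
    (fun Z => Bz Z / Pz Z) (fun Z => Ahz Z / Qz Z) (fun Z => Bhz Z / Qz Z) (fun Z => Qz Z / Pz Z)
    hμ hμw hx1 hy1 hxh1 hyh1 hxanti hyanti hxhanti hyhanti hxh_le hyh_le hxh_eq hyh_eq hρ1 hρ0
    hρle hρ₁ hρ₂ hPA (hCU v₁ hv₁P c₁ hc₁ hleaf₁) (hCU v₂ hv₂P c₂ hc₂ hleaf₂)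

end TwoStarF

end Summit.Ventures.PercRepro2.Coin
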